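import Summits.QuantumFields.YangMills.Theorems.AlphaInputsT3ACDeepFibrePointSizeRows
import Summits.QuantumFields.YangMills.Theorems.AlphaInputsT3ACv3StepLowMaxB3OfLeGamma
import HarnessLib

/-!
# `AlphaInputsT3ACChargeOnInteriorWindow` — ROAD (a) OF ★★OWNER RULING №49 FOR (α)-ROW #23's (E2) RE-CUT: THE WINDOW-RESTRICTED PUSH-FORWARD OF HAAR CHARGES `loPrintAC (k+1)` ALREADY FROM
# THE OPEN INTERIOR WINDOW `O_ε ∩ {χB_k(triv′) ≠ 0} ∩ intWindowT3 k ⊆ loPrintAC k`, NO MINIMISER CONTINUITY (cell `ym3-torus`, (α)-row #23 `fibre57LowOn` at print's family; seat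
# `ym3-torus-px20` g14, width copy of p1 — DOOR 3; a NEW file over w8-19936 g16's ✓A `…AvgFunLocalLowerDensity` ∕ ✓B `…ChargeOfDeepFibrePoint` ∕ ✓E `…v3StepLowMaxB3OfLeGamma` and px20 g13's ✓(L1)
# `…DeepFibrePointOfRows` ∕ ✓`…DeepFibrePointSizeRows`, none of them edited; `--supports stmt-QuantumFields-19936 --as helper`)

WHY (w4-20520 g20 LOCATE `LOCATE-hdom-E2-knockon.v1_1.w4g20.md`, 19936 evidence; RULING №49).  The (E2) residue `hdom` of the lower row (57)∕(47) at print's family has no supplier in print or tree;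
the planner's re-cut RC-B re-routes the row so that `𝟙[loPrintAC k]` (print's `χ_k` of (47) p.267), not the (4)-window factor `χB_k(triv′)` alone, restricts the fibre integrand.  Its
charging letter then reads on the SMALLER charging set `O_ε ∩ {χB_k(triv′) ≠ 0} ∩ loPrintAC k` — `μ_k(that ∩ Ū⁻¹N) = 0 ⇒ μ_{k+1}(N) = 0` for `N ⊆ loPrintAC (k+1)` — and `loPrintAC k`'s
second conjunct `{U | |U_k(U)(∂p) − 1| < ε₁(k)L^{−2k}}` is NOT known to be open (that would be continuity of the minimiser map, [Balaban1985Variational] Sect. G — road (b), not pursued).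
ROAD (a): the OPEN plaquette window `intWindowT3 F 𝔠 γ K k = {W | |W(∂p) − 1| < ε₁(k)∕max(B₃,1)}` lies in `loPrintAC k` (✓`PkgCoreRows.intWindowT3_subset_loPrintAC`, row r1 at the free
radius, under `θBal ≤ a₁`), and the DEEP FIBRE POINT `U₀ := (blockAvg ℰp)^k U_{k+1}(V)` of (L1) lies in it as soon as `2·ε₁(k+1)·L⁻² < ε₁(k)∕max(B₃,1)`, i.e. under the (E1) FLOOR
`2·max(B₃,1)·√L < L²` (✓E `hwin_of_floor` at `c := max B₃ 1`).  THIS FILE: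
* §1 (generic `P`, `SU(N)`; A's currency) `charge_of_deepFibrePoints_of_isOpen` — ✓A `charge_of_deepFibrePoints` with an extra OPEN set `W ∋ U₀` intersected into the charging set (A's
  ✓`exists_local_lower_density_avgFun` is generic in the open neighbourhood; ✓`null_of_local_lower_density` globalises).
* §2 (T³ record numerics; B's currency) `hcharge_inter_of_deepFibrePoints_mem` — ✓B `hcharge_of_deepFibrePoints` with `W`; `hcharge_mono_set` (charging from `S` ⇒ from every `S′ ⊇ S`).
* §3 (record) the EXPLICIT deep point: `avgFun_iterAvg_ukAll` (`Ū U₀ = V`, row r2 at `triv`), `plaqSmall_iterAvg_ukAll` (`|U₀(∂p) − 1| < 2·c·ε₁(k+1)·L⁻²` on `chiMinAC c (k+1)`, sharp symmetric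
  Prop. 2 — (L1)'s steps (1)–(3) for the explicit `U₀`), `iterAvg_ukAll_mem_intWindowT3_of_floor` (print's family `c = 1`, floor ⇒ `U₀ ∈ intWindowT3 k`), `hdeepW_loPrintAC_of_floor`.
* §4 ★★ `hcharge_intWindow_of_floor` (charging set `O_ε ∩ {χB ≠ 0} ∩ intWindowT3 k`; letters `hγs`, `hfloor`) and ★★★ `hcharge_loPrintAC_of_floor` (charging set
  `O_ε ∩ {χB ≠ 0} ∩ loPrintAC k`; letters `hγs`, `ha₁`, `hfloor`) — THE `hcharge` LETTER THE RC-B LOWER ROW WILL DISPLAY, from tree theorems only.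
So the (E2)∕RC-B bill at print's family is {B0's re-cut pin (i), r1′ (`huniq`, ✓`…PrintOrbitOfUniqueMin` + ✓`…MinimiserNestingOfUniqueMin`), the (E1) floor `hfloor`} — no continuity row.

HONEST SCOPE.  [folklore] measure theory and γ∕L arithmetic over landed theorems; def-free; nothing of #23's pins, of the re-cut row itself, of (47)∕(57), the (α) data rows (0∕23), (O‴χₛ),
`HistoryTailL` (19936), EX, LOWB∘ or `YM3TorusSU2` is proved (rung R3 = SU(2) YM₃ on T³, a RECORD rung: NOT d = 4, NOT infinite volume, NOT a mass gap, NOT Clay; the Yang–Mills mass gap is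
NOT proved).  L-floor: `hfloor : 2·max(B₃,1)·√L < L²` (displayed; `L ≥ 5` at `B₃ ∈ (4, 5.59)`).
References: T. Bałaban, Commun. Math. Phys. **102** (1985) 255–275 [Balaban1985UV3] ((7) p.257, (42) p.266, (47) p.267, (49) p.268, p.272 L32–33); **98** (1985) 17–51
[Balaban1985Averaging] (Prop. 2 (52)–(54) p.26); **109** (1987) 249–301 [Balaban1987RG1] ((0.4) p.253); L. C. Evans, R. F. Gariepy, *Measure Theory and Fine Properties of
Functions*, CRC 1992 [EvansGariepy1992] (§3.4.3 Thm 2).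
-/

set_option autoImplicit false

noncomputable section

open scoped Topology ENNReal NNReal
open Set Function MeasureTheory

/-! ## §1 Generic: the charge theorem with an extra open set in the charging set -/

namespace Summit.QuantumFields.YangMills.Theorems.ChargeOnInteriorWindow

open Literature.MathematicalPhysics.QuantumFieldTheory.Balaban1983to89
open Literature.MathematicalPhysics.QuantumFieldTheory.Balaban1983to89.BlockAveraging (Idx avgFun loopHol)
open Literature.MathematicalPhysics.QuantumFieldTheory.Balaban1983to89.ExpMeanLog (expMeanLogSU deltaSU)
open Summit.QuantumFields.Balaban3D.Carriers (Hist)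
open Summit.QuantumFields.Balaban3D.Proofs.Bound55Masses (chiB)
open Summit.QuantumFields.YangMills.Theorems.AvgFunLocalLowerDensity

variable {P : Params} {j : ℕ} {N : ℕ} [NeZero N]

/-- **THE WINDOW-RESTRICTED PUSH-FORWARD CHARGES FROM ANY OPEN SET CONTAINING THE DEEP FIBRE POINTS** — ✓`AvgFunLocalLowerDensity.charge_of_deepFibrePoints` with an extra OPEN `W` in the
charging set: if every `V ∈ L` has a deep fibre point `U₀` (`Ū U₀ = V`, loops `< ε`, `χB_j(triv′)(U₀) ≠ 0`) lying in `W`, then every measurable `N ⊆ L` with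
`μ_j({loops < ε} ∩ {χB ≠ 0} ∩ W ∩ Ū⁻¹N) = 0` is `μ_{j+1}`-null (local lower density of `Ū_*(μ_j↾𝒩)` at `V` for the open `𝒩 := {loops < ε} ∩ {χB ≠ 0} ∩ W`, then Lindelöf).
[cite: Balaban1987RG1, (0.4) p.253; EvansGariepy1992, §3.4.3 Thm 2] -/
theorem charge_of_deepFibrePoints_of_isOpen (hj : j + 1 ≤ P.m + P.K) {ε : ℝ} (hε24 : ε ≤ 1 / 24) (hεδ : ε < deltaSU (Fin N))
    (hεL : 157 * ε < ((P.L : ℝ) ^ (P.d - 1))⁻¹) (M₁ : ℕ) (Rcol : ℕ → ℕ) (εS : ℕ → ℝ)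
    (W : Set (GaugeField P j (Matrix.specialUnitaryGroup (Fin N) ℂ))) (hW : IsOpen W)
    {L : Set (GaugeField P (j + 1) (Matrix.specialUnitaryGroup (Fin N) ℂ))}
    (hdeep : ∀ V ∈ L, ∃ U₀ : GaugeField P j (Matrix.specialUnitaryGroup (Fin N) ℂ), avgFun (expMeanLogSU (n := Fin N)) U₀ = V ∧
      (∀ c i, dist1 (loopHol U₀ c i) < ε) ∧ chiB M₁ Rcol εS j (Hist.triv P (j + 1)) U₀ ≠ 0 ∧ U₀ ∈ W)
    (Nset : Set (GaugeField P (j + 1) (Matrix.specialUnitaryGroup (Fin N) ℂ))) (hN : MeasurableSet Nset) (hNL : Nset ⊆ L)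
    (h0 : fieldMeasure P j (Matrix.specialUnitaryGroup (Fin N) ℂ)
      ({U : GaugeField P j (Matrix.specialUnitaryGroup (Fin N) ℂ) | ∀ c i, dist1 (loopHol U c i) < ε} ∩
        {U | chiB M₁ Rcol εS j (Hist.triv P (j + 1)) U ≠ 0} ∩ W ∩ (avgFun (expMeanLogSU (n := Fin N))) ⁻¹' Nset) = 0) :
    fieldMeasure P (j + 1) (Matrix.specialUnitaryGroup (Fin N) ℂ) Nset = 0 := by
  haveI : SecondCountableTopology (GaugeField P (j + 1) (Matrix.specialUnitaryGroup (Fin N) ℂ)) := T3OrbitAverage.instSecondCountableGaugeField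
  haveI : BorelSpace (GaugeField P (j + 1) (Matrix.specialUnitaryGroup (Fin N) ℂ)) := T3OrbitAverage.instBorelSpaceGaugeField
  have h𝒩 := ((isOpen_setOf_loopHol_lt (P := P) (j := j) (N := N) ε).inter
    (isOpen_setOf_chiB_triv_ne_zero (P := P) (j := j) (N := N) M₁ Rcol εS)).inter hW
  refine null_of_local_lower_density (fieldMeasure P j (Matrix.specialUnitaryGroup (Fin N) ℂ))
    (fieldMeasure P (j + 1) (Matrix.specialUnitaryGroup (Fin N) ℂ)) (avgFun (expMeanLogSU (n := Fin N))) _ (L := L)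
    (fun V hV => ?_) Nset hN hNL h0
  obtain ⟨U₀, hU₀V, hU₀ε, hχ, hU₀W⟩ := hdeep V hV
  obtain ⟨D, hDo, hU₀D, c, hc, hD⟩ :=
    exists_local_lower_density_avgFun (P := P) (j := j) (N := N) hj hε24 hεδ hεL h𝒩 ⟨⟨hU₀ε, hχ⟩, hU₀W⟩ hU₀ε
  exact ⟨D, hDo, hU₀V ▸ hU₀D, c, hc, hD⟩

end Summit.QuantumFields.YangMills.Theorems.ChargeOnInteriorWindow

/-! ## §2 At the T³ record's numerics: ✓B's charging lemma with an extra open set; monotonicity in the charging set -/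

namespace Summit.QuantumFields.YangMills.Theorems.PinnedStepTrivPins

open MeasureTheory Set Literature.MathematicalPhysics.QuantumFieldTheory.Balaban1983to89
open Literature.MathematicalPhysics.QuantumFieldTheory.Balaban1983to89.BlockAveraging (avgFun loopHol Idx)
open Literature.MathematicalPhysics.QuantumFieldTheory.Balaban1983to89.ExpMeanLog (expMeanLogSU deltaSU)
open Literature.MathematicalPhysics.QuantumFieldTheory.Balaban1983to89.T3ContinuumYM3Torus (T3Family)
open Literature.MathematicalPhysics.QuantumFieldTheory.Balaban1985CMP102 Literature.MathematicalPhysics.QuantumFieldTheory.Balaban1985CMP102.Setting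
open Summit.QuantumFields.Balaban3D.Carriers
open Summit.QuantumFields.Balaban3D.Proofs.Primitives (AlphaConsts)
open Summit.QuantumFields.Balaban3D.Proofs.TowerAC Summit.QuantumFields.Balaban3D.Proofs.StandardAC Summit.QuantumFields.Balaban3D.Proofs.InputsAC
open Summit.QuantumFields.Balaban3D.Proofs.Bound55Masses (chiB)
open Summit.QuantumFields.Balaban3D.Proofs.Thresholds (Q0 Q0_pos)
open Summit.QuantumFields.YangMills.Theorems.BlockAvgEMLWeightedFibreChart (loopSmall_of_chiB_triv_ne_zero)
open scoped NNReal ENNReal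

variable (F : T3Family) (K : ℕ) {𝔠 : AlphaConsts F.L (suGroupModel 2).N} (γ : ℝ) (hγ : 0 < γ) (hγ1' : γ ≤ 1)

/-- **✓B WITH AN EXTRA OPEN SET**: at the T³ record on the size line (`hγs`), if every `V ∈ lo (k+1)` has a deep fibre point `U₀` (`Ū U₀ = V`, `χB_k(triv′)(U₀) ≠ 0`) inside the OPEN set `W`,
then the push-forward of Haar restricted to `O_ε ∩ {χB_k(triv′) ≠ 0} ∩ W` charges `lo (k+1)` (the loop conjunct from the window inclusion, as in ✓B).
[cite: Balaban1985UV3, (47) p.267 + (49) p.268; Balaban1987RG1, (0.4) p.253] -/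
theorem hcharge_inter_of_deepFibrePoints_mem (hγs : γ ≤ ((((4500 : ℝ) * (F.L : ℝ) ^ 5)⁻¹ / (𝔠.b₀ * Q0 𝔠.p₀)) ^ 2) ^ 2)
    (lo : (k : ℕ) → Set (GaugeField (F.P K) k (Matrix.specialUnitaryGroup (Fin 2) ℂ))) (k : ℕ) (hk : k ≤ K)
    (W : Set (GaugeField (F.P K) k (Matrix.specialUnitaryGroup (Fin 2) ℂ))) (hW : IsOpen W)
    (hdeepW : ∀ V ∈ lo (k + 1), ∃ U₀ : GaugeField (F.P K) k (Matrix.specialUnitaryGroup (Fin 2) ℂ),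
      avgFun (expMeanLogSU (n := Fin 2)) U₀ = V ∧
        chiB 𝔠.lane.carrier.M₁ (rcolOf (T3Scales F γ hγ hγ1' K) 𝔠.lane.carrier) (eps1Of (T3Scales F γ hγ hγ1' K) 𝔠.lane.carrier) k
          (Hist.triv (F.P K) (k + 1)) U₀ ≠ 0 ∧ U₀ ∈ W) :
    ∀ Nset : Set (GaugeField (F.P K) (k + 1) (Matrix.specialUnitaryGroup (Fin 2) ℂ)), MeasurableSet Nset → Nset ⊆ lo (k + 1) →
      fieldMeasure (F.P K) k (Matrix.specialUnitaryGroup (Fin 2) ℂ)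
        ({U : GaugeField (F.P K) k (Matrix.specialUnitaryGroup (Fin 2) ℂ) | ∀ c i, dist1 (loopHol U c i) < ((Fintype.card (Idx (F.P K)) : ℝ))⁻¹ / 10} ∩
          {U | chiB 𝔠.lane.carrier.M₁ (rcolOf (T3Scales F γ hγ hγ1' K) 𝔠.lane.carrier) (eps1Of (T3Scales F γ hγ hγ1' K) 𝔠.lane.carrier) k (Hist.triv (F.P K) (k + 1)) U ≠ 0} ∩
          W ∩ (avgFun (expMeanLogSU (n := Fin 2))) ⁻¹' Nset) = 0 →
      fieldMeasure (F.P K) (k + 1) (Matrix.specialUnitaryGroup (Fin 2) ℂ) Nset = 0 := by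
  intro Nset hN hNlo h0
  obtain ⟨hεS, hwin⟩ := sizeLine_T3_of_le_gamma (𝔠 := 𝔠) γ hγ hγ1' hγs K k hk
  have hj : k + 1 ≤ (F.P K).m + (F.P K).K := by
    have hm := F.hm
    show k + 1 ≤ F.m + K
    omega
  exact ChargeOnInteriorWindow.charge_of_deepFibrePoints_of_isOpen (P := F.P K) (j := k) (N := 2) hj (chartRadius_T3_le_inv24 F K) (chartRadius_T3_lt_deltaSU2 F K)
    (chartRadius_T3_N09 F K) 𝔠.lane.carrier.M₁ (rcolOf (T3Scales F γ hγ hγ1' K) 𝔠.lane.carrier) (eps1Of (T3Scales F γ hγ hγ1' K) 𝔠.lane.carrier) W hW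
    (L := lo (k + 1))
    (fun V hV => by
      obtain ⟨U₀, hU₀V, hχ, hU₀W⟩ := hdeepW V hV
      exact ⟨U₀, hU₀V, loopSmall_of_chiB_triv_ne_zero _ _ _ k hεS hwin U₀ hχ, hχ, hU₀W⟩)
    Nset hN hNlo h0

/-- **MONOTONICITY OF THE CHARGING LETTER IN THE CHARGING SET**: charging from `S` implies charging from every `S′ ⊇ S` (a null bigger set has null subsets). [folklore] -/
theorem hcharge_mono_set {k : ℕ} (lo : (k : ℕ) → Set (GaugeField (F.P K) k (Matrix.specialUnitaryGroup (Fin 2) ℂ)))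
    {S S' : Set (GaugeField (F.P K) k (Matrix.specialUnitaryGroup (Fin 2) ℂ))} (hSS' : S ⊆ S')
    (h : ∀ Nset : Set (GaugeField (F.P K) (k + 1) (Matrix.specialUnitaryGroup (Fin 2) ℂ)), MeasurableSet Nset → Nset ⊆ lo (k + 1) →
      fieldMeasure (F.P K) k (Matrix.specialUnitaryGroup (Fin 2) ℂ) (S ∩ (avgFun (expMeanLogSU (n := Fin 2))) ⁻¹' Nset) = 0 →
      fieldMeasure (F.P K) (k + 1) (Matrix.specialUnitaryGroup (Fin 2) ℂ) Nset = 0) :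
    ∀ Nset : Set (GaugeField (F.P K) (k + 1) (Matrix.specialUnitaryGroup (Fin 2) ℂ)), MeasurableSet Nset → Nset ⊆ lo (k + 1) →
      fieldMeasure (F.P K) k (Matrix.specialUnitaryGroup (Fin 2) ℂ) (S' ∩ (avgFun (expMeanLogSU (n := Fin 2))) ⁻¹' Nset) = 0 →
      fieldMeasure (F.P K) (k + 1) (Matrix.specialUnitaryGroup (Fin 2) ℂ) Nset = 0 :=
  fun Nset hN hNlo h0 => h Nset hN hNlo (measure_mono_null (inter_subset_inter_left _ hSS') h0)

end Summit.QuantumFields.YangMills.Theorems.PinnedStepTrivPins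

/-! ## §3 At the rows record: the explicit deep fibre point and the interior window -/

namespace Summit.QuantumFields.YangMills.Theorems

open MeasureTheory Literature.MathematicalPhysics.QuantumFieldTheory.Balaban1983to89
open Literature.MathematicalPhysics.QuantumFieldTheory.Balaban1983to89.BlockAveraging (avgFun loopHol Idx blockAvg)
open Literature.MathematicalPhysics.QuantumFieldTheory.Balaban1983to89.ExpMeanLog (expMeanLogSU deltaSU)
open Literature.MathematicalPhysics.QuantumFieldTheory.Balaban1983to89.T3ContinuumYM3Torus
open Literature.MathematicalPhysics.QuantumFieldTheory.Balaban1983to89.T3UnitLawDensityEML (ℰp)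
open Literature.MathematicalPhysics.QuantumFieldTheory.Balaban1983to89.T3UnitScaleTilt (θBal)
open Literature.MathematicalPhysics.QuantumFieldTheory.Balaban1983to89.B10Eq38TorusDomains (plaqsIn)
open Literature.MathematicalPhysics.QuantumFieldTheory.Balaban1983to89.B10Eq42TorusConstraint (bondsIn)
open Literature.MathematicalPhysics.QuantumFieldTheory.Balaban1985CMP102 Literature.MathematicalPhysics.QuantumFieldTheory.Balaban1985CMP102.Setting
open Summit.QuantumFields.Balaban3D.Carriers
open Summit.QuantumFields.Balaban3D.Proofs.Primitives
open Summit.QuantumFields.Balaban3D.Proofs.Thresholds (Q0 Q0_pos)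
open Summit.QuantumFields.Balaban3D.Proofs.TowerAC Summit.QuantumFields.Balaban3D.Proofs.StandardAC Summit.QuantumFields.Balaban3D.Proofs.InputsAC
open Summit.QuantumFields.Balaban3D.Proofs.Bound55Masses (chiB)
open scoped NNReal ENNReal

/-- The interior window `intWindowT3` is an OPEN plaquette window. [cite: Balaban1987RG1, (0.18) p.255] -/
theorem AlphaInputsT3AC.isOpen_intWindowT3 (F : T3Family) (𝔠 : AlphaConsts F.L (suGroupModel 2).N) (γ : ℝ) (K k : ℕ) :
    IsOpen (AlphaInputsT3AC.intWindowT3 F 𝔠 γ K k) :=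
  isOpen_setOf_plaqSmall_SU2 (P := F.P K) (j := k) _

variable {F : T3Family} {𝔠 : AlphaConsts F.L (suGroupModel 2).N} {γ : ℝ} {hγ : 0 < γ} {hγ1 : γ ≤ (min 𝔠.gamma0 1) ^ 2} {K : ℕ}

namespace AlphaInputsT3AC.PkgCoreRows

variable (q : AlphaInputsT3AC.PkgCoreRows F 𝔠 γ hγ hγ1 K)

/-- **THE EXPLICIT DEEP POINT AVERAGES TO `V`**: for `V` in the level-`(k+1)` (4)-window, `Ū((blockAvg ℰp)^k U_{k+1}(V)) = V` — row r2 at the trivial history (`Ω_{k+1} = T`; (L1)'s step (3)).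
[cite: Balaban1985UV3, (42) p.266] -/
theorem avgFun_iterAvg_ukAll (k : ℕ) (hk : k + 1 ≤ K) (V : GaugeField (F.P K) (k + 1) (Matrix.specialUnitaryGroup (Fin 2) ℂ))
    (hVw : PlaqSmall (eps1Of (T3Scales F γ hγ (hγ1.trans (sq_min_one_le _ 𝔠.gamma0_pos)) K) 𝔠.lane.carrier (k + 1)) V) :
    avgFun (expMeanLogSU (n := Fin 2)) (Averaging.iter (fun i => BlockAveraging.blockAvg (P := F.P K) (j := i) ℰp) k (ukAll q.X.Uk (k + 1) V)) = V := by
  set S := T3Scales F γ hγ (hγ1.trans (sq_min_one_le _ 𝔠.gamma0_pos)) K with hS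
  have hL1 : 1 ≤ F.L := by have := F.hL.2; omega
  have hLpos : (0 : ℝ) < F.L := by exact_mod_cast (by omega : 0 < F.L)
  rw [← q.X.UkH_triv (k + 1) V]
  have hCh : ChargedT3 F γ 𝔠.b₀ 𝔠.p₀ (avgWindowFactor F.L) K 𝔠.lane.carrier.M₁ (rcolOf S 𝔠.lane.carrier) (k + 1) (Hist.triv (F.P K) (k + 1)) V := by
    refine ⟨Hist.admissible_triv _ _ _, fun p _ => (hVw p).trans_le ?_⟩
    -- `ε₁(k+1) = θ(K−k−1) ≤ √L·θ(K−k) ≤ 2L²·awf(L)·θ(K−(k+1)+1)` ((L1)'s step (3) verbatim)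
    have hidx : K - (k + 1) + 1 = K - k := by omega
    rw [hidx]
    have heps : eps1Of S 𝔠.lane.carrier (k + 1) = θBal F.L γ 𝔠.b₀ 𝔠.p₀ (K - (k + 1)) := by rw [hS]; exact q.eps1_eq (k + 1) hk
    rw [heps]
    have hγ1' : γ ≤ 1 := hγ1.trans (sq_min_one_le _ 𝔠.gamma0_pos)
    have hstep := T3SmallLiftHistory.sqrt_inv_mul_θBal_le_succ (L := F.L) (γ := γ) (b₀ := 𝔠.b₀) (p₀ := 𝔠.p₀)
      hL1 hγ hγ1' 𝔠.b₀_pos.le 𝔠.p₀_pos.le (K - (k + 1))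
    rw [hidx] at hstep
    have hθpos : 0 ≤ θBal F.L γ 𝔠.b₀ 𝔠.p₀ (K - k) := (q.θBal_pos k (by omega)).le
    have hsq : 0 < Real.sqrt ((F.L : ℝ)⁻¹) := Real.sqrt_pos.2 (inv_pos.2 hLpos)
    have h1 : θBal F.L γ 𝔠.b₀ 𝔠.p₀ (K - (k + 1)) ≤ (Real.sqrt ((F.L : ℝ)⁻¹))⁻¹ * θBal F.L γ 𝔠.b₀ 𝔠.p₀ (K - k) := by
      rw [le_inv_mul_iff₀ hsq]; exact hstep
    refine h1.trans (mul_le_mul_of_nonneg_right ?_ hθpos)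
    have hawf : 1 ≤ avgWindowFactor F.L := by
      unfold avgWindowFactor
      have : (1 : ℝ) ≤ (F.L : ℝ) ^ 2 := by nlinarith [show (1:ℝ) ≤ F.L by exact_mod_cast hL1]
      nlinarith [sq_nonneg ((((3 + 2) * F.L : ℕ) : ℝ))]
    have hsqrt_le : (Real.sqrt ((F.L : ℝ)⁻¹))⁻¹ ≤ (F.L : ℝ) := by
      rw [Real.sqrt_inv, inv_inv]
      calc Real.sqrt (F.L : ℝ) ≤ Real.sqrt ((F.L : ℝ) ^ 2) :=
            Real.sqrt_le_sqrt (by nlinarith [show (1:ℝ) ≤ F.L by exact_mod_cast hL1])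
        _ = (F.L : ℝ) := Real.sqrt_sq hLpos.le
    calc (Real.sqrt ((F.L : ℝ)⁻¹))⁻¹ ≤ (F.L : ℝ) := hsqrt_le
      _ ≤ 2 * (F.L : ℝ) ^ 2 * 1 := by nlinarith [show (1:ℝ) ≤ F.L by exact_mod_cast hL1]
      _ ≤ 2 * (F.L : ℝ) ^ 2 * avgWindowFactor F.L := by gcongr
  have hfib := q.minRows.2.1 (k + 1) hk (Hist.triv (F.P K) (k + 1)) V hCh
  funext b
  have hb : b ∈ bondsIn (k + 1) (Omega 𝔠.lane.carrier.M₁ (rcolOf S 𝔠.lane.carrier) (k + 1) (Hist.triv (F.P K) (k + 1)) (k + 1)) := by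
    rw [Omega_triv]; exact ⟨Set.mem_univ _, Set.mem_univ _⟩
  exact hfib b hb

/-- **THE EXPLICIT DEEP POINT IS `2α₀`-SMALL**, `α₀ := c·ε₁(k+1)·L⁻²`: for `V ∈ chiMinAC c (k+1)` (print's minimiser window at constant `c`), under the two sharp-Prop.-2 size rows `hP3`, `hP2`,
`|((blockAvg ℰp)^k U_{k+1}(V))(∂p) − 1| < 2α₀` for every level-`k` plaquette ((L1)'s steps (1)–(2): `|U_{k+1}(V)(∂p) − 1| < c·ε₁(k+1)·L^{−2(k+1)} = α₀·L^{−2k}` and the sharp symmetric Prop. 2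
✓`BlockAveragingEMLProp2.plaqSmall_iter_blockAvg_eml_level`). [cite: Balaban1985UV3, (47) p.267; Balaban1985Averaging, Prop. 2 (52)–(54) p.26] -/
theorem plaqSmall_iterAvg_ukAll (k : ℕ) (hk : k + 1 ≤ K) {c : ℝ} (hc : 0 < c)
    (hP3 : (143 * (((((F.P K).d + 4 : ℕ) : ℝ)) ^ 2 / 4) ^ 2) *
      (c * eps1Of (T3Scales F γ hγ (hγ1.trans (sq_min_one_le _ 𝔠.gamma0_pos)) K) 𝔠.lane.carrier (k + 1) * ((F.L : ℝ)⁻¹) ^ 2) ≤ 1 / 3)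
    (hP2 : 2 * (c * eps1Of (T3Scales F γ hγ (hγ1.trans (sq_min_one_le _ 𝔠.gamma0_pos)) K) 𝔠.lane.carrier (k + 1) * ((F.L : ℝ)⁻¹) ^ 2) ≤
      2 * deltaSU (Fin 2) / ((((F.P K).d + 4) * (F.P K).L : ℕ) : ℝ) ^ 2)
    (V : GaugeField (F.P K) (k + 1) (Matrix.specialUnitaryGroup (Fin 2) ℂ)) (hVc : V ∈ PinnedStep.chiMinAC 𝔠.lane q.X c (k + 1)) :
    PlaqSmall (2 * (c * eps1Of (T3Scales F γ hγ (hγ1.trans (sq_min_one_le _ 𝔠.gamma0_pos)) K) 𝔠.lane.carrier (k + 1) * ((F.L : ℝ)⁻¹) ^ 2))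
      (Averaging.iter (fun i => BlockAveraging.blockAvg (P := F.P K) (j := i) ℰp) k (ukAll q.X.Uk (k + 1) V)) := by
  set S := T3Scales F γ hγ (hγ1.trans (sq_min_one_le _ 𝔠.gamma0_pos)) K with hS
  set ε1 : ℝ := eps1Of S 𝔠.lane.carrier (k + 1) with hε1
  set α₀ : ℝ := c * ε1 * ((F.L : ℝ)⁻¹) ^ 2 with hα₀
  have hL1 : 1 ≤ F.L := by have := F.hL.2; omega
  have hε1pos : 0 < ε1 := by
    have h' : eps1Of S 𝔠.lane.carrier (k + 1) = θBal F.L γ 𝔠.b₀ 𝔠.p₀ (K - (k + 1)) := q.eps1_eq (k + 1) hk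
    rw [hε1, h']; exact q.θBal_pos (k + 1) hk
  have hα₀pos : 0 < α₀ := by rw [hα₀]; positivity
  -- (1) regularity of the finest minimiser from print's χ at constant `c`
  have hreg : PlaqSmall (c * ε1 * ((F.L : ℝ)⁻¹) ^ (2 * (k + 1))) (ukAll q.X.Uk (k + 1) V) :=
    (PinnedStep.mem_chiMinAC_iff 𝔠.lane q.X c (k + 1) V).1 hVc
  have h52 : PlaqSmall (α₀ * ((((F.P K).L : ℝ) ^ k)⁻¹) ^ 2) (ukAll q.X.Uk (k + 1) V) := by
    intro p
    refine (hreg p).trans_le (le_of_eq ?_)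
    rw [hα₀]
    show c * ε1 * ((F.L : ℝ)⁻¹) ^ (2 * (k + 1)) = c * ε1 * ((F.L : ℝ)⁻¹) ^ 2 * ((((F.L : ℝ)) ^ k)⁻¹) ^ 2
    rw [← inv_pow, ← pow_mul, show 2 * (k + 1) = 2 + k * 2 by ring, pow_add]
    ring
  -- (2) the sharp symmetric Prop. 2 at level `k`
  have havg := BlockAveragingEMLProp2.plaqSmall_iter_blockAvg_eml_level (P := F.P K) (n := Fin 2) k hα₀pos hP3 hP2 h52 (le_refl k)
  intro p
  have h := havg p
  have hLk : ((F.P K).L : ℝ) ^ k * (((F.P K).L : ℝ) ^ k)⁻¹ = 1 :=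
    mul_inv_cancel₀ (pow_ne_zero _ (by exact_mod_cast (by omega : F.L ≠ 0)))
  rw [hLk, one_pow, mul_one] at h
  exact h

/-- **THE EXPLICIT DEEP POINT LIES IN THE INTERIOR WINDOW UNDER THE (E1) FLOOR** (print's family, `c = 1`): on the size window `hγs` (for the two Prop.-2 rows at `c = 1`,
✓`PinnedStepTrivPins.sizeRows_one_of_le_gamma`) and under `hfloor : 2·max(B₃,1)·√L < L²`, every `V ∈ loPrintAC (k+1)` has `(blockAvg ℰp)^k U_{k+1}(V) ∈ intWindowT3 F 𝔠 γ K k`: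
`|U₀(∂p) − 1| < 2·ε₁(k+1)·L⁻² < ε₁(k)∕max(B₃,1)` (✓E `hwin_of_floor` at `c := max B₃ 1`). [cite: Balaban1985UV3, (7) p.257 + (47) p.267; Balaban1985Averaging, Prop. 2 (54) p.26] -/
theorem iterAvg_ukAll_mem_intWindowT3_of_floor (hγs : γ ≤ ((((4500 : ℝ) * (F.L : ℝ) ^ 5)⁻¹ / (𝔠.b₀ * Q0 𝔠.p₀)) ^ 2) ^ 2)
    (hfloor : 2 * max 𝔠.B₃ 1 * Real.sqrt (F.L : ℝ) < (F.L : ℝ) ^ 2) (k : ℕ) (hk : k + 1 ≤ K)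
    (V : GaugeField (F.P K) (k + 1) (Matrix.specialUnitaryGroup (Fin 2) ℂ)) (hV : V ∈ PinnedStep.loPrintAC 𝔠.lane q.X (k + 1)) :
    Averaging.iter (fun i => BlockAveraging.blockAvg (P := F.P K) (j := i) ℰp) k (ukAll q.X.Uk (k + 1) V) ∈ AlphaInputsT3AC.intWindowT3 F 𝔠 γ K k := by
  have hγ1' : γ ≤ 1 := hγ1.trans (sq_min_one_le _ 𝔠.gamma0_pos)
  obtain ⟨hP3, hP2, -, -⟩ := PinnedStepTrivPins.sizeRows_one_of_le_gamma (F := F) (𝔠 := 𝔠) γ hγ hγ1' hγs K k hk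
  have hB0 : 0 < max 𝔠.B₃ 1 := lt_of_lt_of_le one_pos (le_max_right _ _)
  -- the floor at weight `max B₃ 1`: `2·(max(B₃,1)·ε₁(k+1)·L⁻²) < ε₁(k)`
  have hwin := PinnedStepTrivPins.hwin_of_floor (F := F) (𝔠 := 𝔠) γ hγ hγ1' K k hk hB0.le hfloor
  have hsmall := q.plaqSmall_iterAvg_ukAll k hk one_pos hP3 hP2 V hV.2
  have heps : eps1Of (T3Scales F γ hγ hγ1' K) 𝔠.lane.carrier k = θBal F.L γ 𝔠.b₀ 𝔠.p₀ (K - k) := q.eps1_eq k (by omega)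
  intro p
  refine (hsmall p).trans ?_
  -- `2·(1·ε₁(k+1)·L⁻²) < ε₁(k)∕max(B₃,1)`
  show 2 * (1 * eps1Of (T3Scales F γ hγ hγ1' K) 𝔠.lane.carrier (k + 1) * ((F.L : ℝ)⁻¹) ^ 2) < θBal F.L γ 𝔠.b₀ 𝔠.p₀ (K - k) / max 𝔠.B₃ 1
  rw [← heps, lt_div_iff₀ hB0]
  calc 2 * (1 * eps1Of (T3Scales F γ hγ hγ1' K) 𝔠.lane.carrier (k + 1) * ((F.L : ℝ)⁻¹) ^ 2) * max 𝔠.B₃ 1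
      = 2 * (max 𝔠.B₃ 1 * eps1Of (T3Scales F γ hγ hγ1' K) 𝔠.lane.carrier (k + 1) * ((F.L : ℝ)⁻¹) ^ 2) := by ring
    _ < eps1Of (T3Scales F γ hγ hγ1' K) 𝔠.lane.carrier k := hwin

/-- **THE DEEP-FIBRE-POINT LETTER WITH THE INTERIOR WINDOW, ON PRINT'S FAMILY**: under `hγs` and the floor, every `V ∈ loPrintAC (k+1)` has a point `U₀` with `Ū U₀ = V`, `χB_k(triv′)(U₀) ≠ 0`
and `U₀ ∈ intWindowT3 k` (the explicit `U₀ := (blockAvg ℰp)^k U_{k+1}(V)`; `χB ≠ 0` because `intWindowT3 k ⊆` the (4)-window, `max(B₃,1) ≥ 1`).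
[cite: Balaban1985UV3, (42) p.266 + (47) p.267 + (49) p.268] -/
theorem hdeepW_loPrintAC_of_floor (hγs : γ ≤ ((((4500 : ℝ) * (F.L : ℝ) ^ 5)⁻¹ / (𝔠.b₀ * Q0 𝔠.p₀)) ^ 2) ^ 2)
    (hfloor : 2 * max 𝔠.B₃ 1 * Real.sqrt (F.L : ℝ) < (F.L : ℝ) ^ 2) (k : ℕ) (hk : k + 1 ≤ K) :
    ∀ V ∈ PinnedStep.loPrintAC 𝔠.lane q.X (k + 1), ∃ U₀ : GaugeField (F.P K) k (Matrix.specialUnitaryGroup (Fin 2) ℂ),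
      avgFun (expMeanLogSU (n := Fin 2)) U₀ = V ∧
        chiB 𝔠.lane.carrier.M₁ (rcolOf (T3Scales F γ hγ (hγ1.trans (sq_min_one_le _ 𝔠.gamma0_pos)) K) 𝔠.lane.carrier)
          (eps1Of (T3Scales F γ hγ (hγ1.trans (sq_min_one_le _ 𝔠.gamma0_pos)) K) 𝔠.lane.carrier) k (Hist.triv (F.P K) (k + 1)) U₀ ≠ 0 ∧
        U₀ ∈ AlphaInputsT3AC.intWindowT3 F 𝔠 γ K k := by
  intro V hV
  have hint := q.iterAvg_ukAll_mem_intWindowT3_of_floor hγs hfloor k hk V hV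
  refine ⟨_, q.avgFun_iterAvg_ukAll k hk V hV.1, ?_, hint⟩
  -- `intWindowT3 k ⊆ {χB_k(triv′) ≠ 0}` (the (4)-window at radius `ε₁(k)∕max(B₃,1) ≤ ε₁(k)`)
  have hB1 : 1 ≤ max 𝔠.B₃ 1 := le_max_right _ _
  have heps : eps1Of (T3Scales F γ hγ (hγ1.trans (sq_min_one_le _ 𝔠.gamma0_pos)) K) 𝔠.lane.carrier k = θBal F.L γ 𝔠.b₀ 𝔠.p₀ (K - k) :=
    q.eps1_eq k (by omega)
  have hθ : 0 < θBal F.L γ 𝔠.b₀ 𝔠.p₀ (K - k) := q.θBal_pos k (by omega)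
  have hall : PlaqSmall (eps1Of (T3Scales F γ hγ (hγ1.trans (sq_min_one_le _ 𝔠.gamma0_pos)) K) 𝔠.lane.carrier k)
      (Averaging.iter (fun i => BlockAveraging.blockAvg (P := F.P K) (j := i) ℰp) k (ukAll q.X.Uk (k + 1) V)) := by
    intro p
    refine (hint p).trans_le ?_
    rw [heps]
    exact div_le_self hθ.le hB1
  have h1 := Summit.QuantumFields.Balaban3D.Proofs.FibreClash.chiB_triv_eq (S := T3Scales F γ hγ (hγ1.trans (sq_min_one_le _ 𝔠.gamma0_pos)) K) (k := k)
    𝔠.lane.carrier.M₁ (rcolOf (T3Scales F γ hγ (hγ1.trans (sq_min_one_le _ 𝔠.gamma0_pos)) K) 𝔠.lane.carrier)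
    (eps1Of (T3Scales F γ hγ (hγ1.trans (sq_min_one_le _ 𝔠.gamma0_pos)) K) 𝔠.lane.carrier)
    (Averaging.iter (fun i => BlockAveraging.blockAvg (P := F.P K) (j := i) ℰp) k (ukAll q.X.Uk (k + 1) V))
  have h2 : chiB 𝔠.lane.carrier.M₁ (rcolOf (T3Scales F γ hγ (hγ1.trans (sq_min_one_le _ 𝔠.gamma0_pos)) K) 𝔠.lane.carrier)
      (eps1Of (T3Scales F γ hγ (hγ1.trans (sq_min_one_le _ 𝔠.gamma0_pos)) K) 𝔠.lane.carrier) k (Hist.triv (F.P K) (k + 1))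
      (Averaging.iter (fun i => BlockAveraging.blockAvg (P := F.P K) (j := i) ℰp) k (ukAll q.X.Uk (k + 1) V)) = 1 :=
    h1.trans (if_pos hall)
  rw [h2]
  exact one_ne_zero

/-! ## §4 The charging letters of the re-cut lower row, from the interior window -/

/-- ★★ **CHARGING FROM THE INTERIOR WINDOW**: on the size window and under the floor, for every measurable `N ⊆ loPrintAC (k+1)`,
`μ_k(O_ε ∩ {χB_k(triv′) ≠ 0} ∩ intWindowT3 k ∩ Ū⁻¹N) = 0 ⇒ μ_{k+1}(N) = 0` — §2 with `W := intWindowT3 k` (open) and §3's deep points. NO row r1, NO minimiser continuity.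
[cite: Balaban1985UV3, (47) p.267 + (49) p.268; Balaban1987RG1, (0.4) p.253] -/
theorem hcharge_intWindow_of_floor (hγs : γ ≤ ((((4500 : ℝ) * (F.L : ℝ) ^ 5)⁻¹ / (𝔠.b₀ * Q0 𝔠.p₀)) ^ 2) ^ 2)
    (hfloor : 2 * max 𝔠.B₃ 1 * Real.sqrt (F.L : ℝ) < (F.L : ℝ) ^ 2) (k : ℕ) (hk : k + 1 ≤ K) :
    ∀ Nset : Set (GaugeField (F.P K) (k + 1) (Matrix.specialUnitaryGroup (Fin 2) ℂ)), MeasurableSet Nset → Nset ⊆ PinnedStep.loPrintAC 𝔠.lane q.X (k + 1) →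
      fieldMeasure (F.P K) k (Matrix.specialUnitaryGroup (Fin 2) ℂ)
        ({U : GaugeField (F.P K) k (Matrix.specialUnitaryGroup (Fin 2) ℂ) | ∀ c i, dist1 (loopHol U c i) < ((Fintype.card (Idx (F.P K)) : ℝ))⁻¹ / 10} ∩
          {U | chiB 𝔠.lane.carrier.M₁ (rcolOf (T3Scales F γ hγ (hγ1.trans (sq_min_one_le _ 𝔠.gamma0_pos)) K) 𝔠.lane.carrier)
              (eps1Of (T3Scales F γ hγ (hγ1.trans (sq_min_one_le _ 𝔠.gamma0_pos)) K) 𝔠.lane.carrier) k (Hist.triv (F.P K) (k + 1)) U ≠ 0} ∩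
          AlphaInputsT3AC.intWindowT3 F 𝔠 γ K k ∩ (avgFun (expMeanLogSU (n := Fin 2))) ⁻¹' Nset) = 0 →
      fieldMeasure (F.P K) (k + 1) (Matrix.specialUnitaryGroup (Fin 2) ℂ) Nset = 0 :=
  PinnedStepTrivPins.hcharge_inter_of_deepFibrePoints_mem F K γ hγ (hγ1.trans (sq_min_one_le _ 𝔠.gamma0_pos)) hγs (PinnedStep.loPrintAC 𝔠.lane q.X) k (by omega)
    (AlphaInputsT3AC.intWindowT3 F 𝔠 γ K k) (AlphaInputsT3AC.isOpen_intWindowT3 F 𝔠 γ K k) (q.hdeepW_loPrintAC_of_floor hγs hfloor k hk)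

/-- ★★★ **THE CHARGING LETTER OF THE RC-B LOWER ROW AT PRINT'S FAMILY** — charging set `O_ε ∩ {χB_k(triv′) ≠ 0} ∩ loPrintAC k` (the support, inside `O_ε`, of the re-cut integrand
`χB·𝟙[loPrintAC k]`): on the size window, under the [7] data-smallness threshold `ha₁ : θBal ≤ q.a₁` (for ✓`intWindowT3_subset_loPrintAC`, row r1 at the free radius) and the (E1) floor, for every
measurable `N ⊆ loPrintAC (k+1)`, `μ_k(O_ε ∩ {χB ≠ 0} ∩ loPrintAC k ∩ Ū⁻¹N) = 0 ⇒ μ_{k+1}(N) = 0` (★★ + monotonicity in the charging set).  NO minimiser continuity (road (a) of RULING №49).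
[cite: Balaban1985UV3, (47) p.267 + (49) p.268 + p.272 L32–33; Balaban1985Variational, Thm 1 (8) p.279] -/
theorem hcharge_loPrintAC_of_floor (hγs : γ ≤ ((((4500 : ℝ) * (F.L : ℝ) ^ 5)⁻¹ / (𝔠.b₀ * Q0 𝔠.p₀)) ^ 2) ^ 2)
    (ha₁ : ∀ i, θBal F.L γ 𝔠.b₀ 𝔠.p₀ i ≤ q.a₁) (hfloor : 2 * max 𝔠.B₃ 1 * Real.sqrt (F.L : ℝ) < (F.L : ℝ) ^ 2) (k : ℕ) (hk : k + 1 ≤ K) :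
    ∀ Nset : Set (GaugeField (F.P K) (k + 1) (Matrix.specialUnitaryGroup (Fin 2) ℂ)), MeasurableSet Nset → Nset ⊆ PinnedStep.loPrintAC 𝔠.lane q.X (k + 1) →
      fieldMeasure (F.P K) k (Matrix.specialUnitaryGroup (Fin 2) ℂ)
        ({U : GaugeField (F.P K) k (Matrix.specialUnitaryGroup (Fin 2) ℂ) | ∀ c i, dist1 (loopHol U c i) < ((Fintype.card (Idx (F.P K)) : ℝ))⁻¹ / 10} ∩
          {U | chiB 𝔠.lane.carrier.M₁ (rcolOf (T3Scales F γ hγ (hγ1.trans (sq_min_one_le _ 𝔠.gamma0_pos)) K) 𝔠.lane.carrier)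
              (eps1Of (T3Scales F γ hγ (hγ1.trans (sq_min_one_le _ 𝔠.gamma0_pos)) K) 𝔠.lane.carrier) k (Hist.triv (F.P K) (k + 1)) U ≠ 0} ∩
          PinnedStep.loPrintAC 𝔠.lane q.X k ∩ (avgFun (expMeanLogSU (n := Fin 2))) ⁻¹' Nset) = 0 →
      fieldMeasure (F.P K) (k + 1) (Matrix.specialUnitaryGroup (Fin 2) ℂ) Nset = 0 :=
  PinnedStepTrivPins.hcharge_mono_set F K (PinnedStep.loPrintAC 𝔠.lane q.X)
    (Set.inter_subset_inter_right _ (q.intWindowT3_subset_loPrintAC ha₁ k (by omega))) (q.hcharge_intWindow_of_floor hγs hfloor k hk)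

end AlphaInputsT3AC.PkgCoreRows

end Summit.QuantumFields.YangMills.Theorems

end
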